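import Summits.ValiantsHypothesis.ValiantsHypothesis.Theorems.PerDivisionHard.Negative.PerLowDegreeRung
import Summits.ValiantsHypothesis.ValiantsHypothesis.Theorems.DivisionGapPerDivisionHardStubBlockArsenalAux

/-!
# Crux `DivisionGap.PerDivisionHard` (stmt-ValiantsHypothesis-5065), line `pair-descent-jss-endpoint` —
stub `stub_rectKill`: the RECTANGLE FACE (deficiency rung)

`h ∈ ℝ≥0[x_{rc}]` homogeneous of degree `d` with a monomial `u` AVOIDING the rectangle
`R = A × B` (rows `A`, columns `B`); the weight `w` is `0` on `R`, `1` elsewhere (hypothesis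
`hw`); `j = |A| + |B| - n`.  Since `weight_w v + |v|_R = deg v`, the top `w`-component
`top_w h ≠ 0` consists of monomials avoiding `R` (`avoids_of_mem_support_topComponent`).  The
projection `π` (hypothesis `hπ`: `1` off `R`, `0` on `R ∖ (A₀ × B₀)`, fresh variables on a
`j × j` block `A₀ × B₀ ⊆ R`) sends `top_w h` to a nonzero constant and `top_w per_n` to a
polynomial with the SUPPORT of `per_j` (`support_aeval_rectProj_topComponent_perPoly`: by
pigeonhole every permutation sends `≥ j` columns of `B` into `A`; a surviving one sends exactly
`B₀` into `A`, onto `A₀`; every permutation of the block is realised, `exists_perm_realising`).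
With `topComponent_mul` and `complexity_gt_of_perSupport_projection c 1`:
`2^{(log₂ n + c)^c} + 1 < L(top_w (per_n · h))`. [folklore]
-/

noncomputable section

-- the tree's mandated layout duplicates the namespace component `ValiantsHypothesis`
set_option linter.dupNamespace false

namespace Summit.ValiantsHypothesis.ValiantsHypothesis.Theorems.DivisionGapPerDivisionHard

open MvPolynomial Literature.Computability.AlgebraicComplexity
open Literature.Barriers.ValiantsHypothesis (JerrumSnir.support_smul_eq)
open Summit.ValiantsHypothesis.ValiantsHypothesis.Theorems.ZeroOneTransfer.Negative
open scoped NNReal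

variable {n : ℕ} {A B : Finset (Fin n)} {w : Fin n × Fin n → ℕ}

/-- `weight_w v + |v|_{A × B} = deg v` for the rectangle weight `w` (`0` on `A × B`, `1`
elsewhere). [folklore] -/
theorem weight_rect_add (hw : ∀ e, w e = if e.1 ∈ A ∧ e.2 ∈ B then 0 else 1)
    (v : (Fin n × Fin n) →₀ ℕ) :
    Finsupp.weight w v + ∑ e ∈ v.support, (if e.1 ∈ A ∧ e.2 ∈ B then v e else 0) =
      v.degree := by
  rw [Finsupp.weight_apply, Finsupp.sum, Finsupp.degree_apply, ← Finset.sum_add_distrib]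
  refine Finset.sum_congr rfl fun e _ => ?_
  rw [hw e]
  split_ifs <;> simp

/-- The rectangle weight of a monomial is its degree iff the monomial avoids the rectangle.
[folklore] -/
theorem weight_rect_eq_degree_iff (hw : ∀ e, w e = if e.1 ∈ A ∧ e.2 ∈ B then 0 else 1)
    (v : (Fin n × Fin n) →₀ ℕ) :
    Finsupp.weight w v = v.degree ↔ ∀ e : Fin n × Fin n, e.1 ∈ A → e.2 ∈ B → v e = 0 :=
    by
  rw [← weight_rect_add hw v, left_eq_add, Finset.sum_eq_zero_iff]
  simp only [ite_eq_right_iff, Finsupp.mem_support_iff, and_imp]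
  exact ⟨fun H e hA hB => by_contra fun hne => hne (H e hne hA hB),
    fun H e _ hA hB => H e hA hB⟩

/-- **The top rectangle component of a homogeneous `h` with a monomial avoiding the rectangle
consists of monomials avoiding it** (the top weight `d` is attained exactly by them). [folklore] -/
theorem avoids_of_mem_support_topComponent
    (hw : ∀ e, w e = if e.1 ∈ A ∧ e.2 ∈ B then 0 else 1)
    {h : MvPolynomial (Fin n × Fin n) ℝ≥0} {d : ℕ} {u : (Fin n × Fin n) →₀ ℕ}
    (hhom : h.IsHomogeneous d) (hu : u ∈ h.support)
    (havoid : ∀ e : Fin n × Fin n, e.1 ∈ A → e.2 ∈ B → u e = 0)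
    {v : (Fin n × Fin n) →₀ ℕ} (hv : v ∈ (topComponent w h).support) :
    ∀ e : Fin n × Fin n, e.1 ∈ A → e.2 ∈ B → v e = 0 := by
  have hdeg : ∀ v ∈ h.support, v.degree = d :=
    fun v hv => of_not_not fun hne => (mem_support_iff.mp hv) (hhom.coeff_eq_zero hne)
  have htop : weightedTotalDegree w h = d := by
    apply le_antisymm
    · exact Finset.sup_le fun v hv => (Nat.le.intro (weight_rect_add hw v)).trans (hdeg v hv).le
    · have hwu : Finsupp.weight w u = d := by
        rw [(weight_rect_eq_degree_iff hw u).mpr havoid, hdeg u hu]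
      exact hwu ▸ le_weightedTotalDegree _ hu
  have hv' := support_topComponent_subset _ h hv
  rw [mem_support_iff, coeff_topComponent, htop] at hv
  split_ifs at hv with hwt
  · exact (weight_rect_eq_degree_iff hw v).mp (hwt.trans (hdeg v hv').symm)
  · exact absurd rfl hv

/-- `weight_w μ_σ + #{i ∈ B : σ i ∈ A} = n` for a permutation monomial. [folklore] -/
theorem weight_rect_permMonomial (hw : ∀ e, w e = if e.1 ∈ A ∧ e.2 ∈ B then 0 else 1)
    (σ : Equiv.Perm (Fin n)) :
    Finsupp.weight w (permMonomial σ) + (B.filter fun i => σ i ∈ A).card = n := by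
  classical
  rw [permMonomial, map_sum]
  simp_rw [Finsupp.weight_single, smul_eq_mul, one_mul, hw]
  have h1 : ∑ i : Fin n, (if σ i ∈ A ∧ i ∈ B then 0 else 1) =
      (Finset.univ.filter fun i => ¬ (σ i ∈ A ∧ i ∈ B)).card := by
    rw [Finset.card_filter]
    exact Finset.sum_congr rfl fun i _ => by rw [ite_not]
  rw [h1, show (B.filter fun i => σ i ∈ A) = Finset.univ.filter (fun i => σ i ∈ A ∧ i ∈ B)
    by ext i; simp [and_comm], add_comm, Finset.card_filter_add_card_filter_not,
    Finset.card_univ, Fintype.card_fin]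

/-- **Pigeonhole.**  Every permutation sends at least `|A| + |B| - n` columns of `B` into `A`.
[folklore] -/
theorem le_card_filter_perm (A B : Finset (Fin n)) (σ : Equiv.Perm (Fin n)) :
    A.card + B.card - n ≤ (B.filter fun i => σ i ∈ A).card := by
  classical
  have h1 : (B.filter fun i => σ i ∉ A).card ≤ (Finset.univ \ A).card :=
    Finset.card_le_card_of_injOn σ
      (fun i hi => Finset.mem_sdiff.mpr ⟨Finset.mem_univ _, (Finset.mem_filter.mp hi).2⟩)
      σ.injective.injOn
  rw [Finset.card_sdiff_of_subset (Finset.subset_univ A), Finset.card_univ,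
    Fintype.card_fin] at h1
  have h2 : (B.filter fun i => σ i ∈ A).card + (B.filter fun i => σ i ∉ A).card = B.card :=
    Finset.card_filter_add_card_filter_not _
  have hA : A.card ≤ n := (Finset.card_le_univ A).trans_eq (Fintype.card_fin n)
  omega

/-- A permutation sending at most `|A| + |B| - n` columns of `B` into `A` has the maximal
rectangle weight `n - (|A| + |B| - n)`, so its monomial lies in `top_w per_n`. [folklore] -/
theorem permMonomial_mem_support_topComponent
    (hw : ∀ e, w e = if e.1 ∈ A ∧ e.2 ∈ B then 0 else 1) {σ : Equiv.Perm (Fin n)}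
    (hcard : (B.filter fun i => σ i ∈ A).card ≤ A.card + B.card - n) :
    permMonomial σ ∈ (topComponent w (perPoly (Fin n) ℝ≥0)).support := by
  classical
  have hmax : weightedTotalDegree w (perPoly (Fin n) ℝ≥0) ≤ n - (A.card + B.card - n) := by
    refine Finset.sup_le fun v hv => ?_
    obtain ⟨ρ, rfl⟩ :=
      exists_permMonomial_eq_of_coeff_perPoly_ne_zero ℝ≥0 (mem_support_iff.mp hv)
    have h1 := weight_rect_permMonomial hw ρ
    have h2 := le_card_filter_perm A B ρ
    show Finsupp.weight w (permMonomial ρ) ≤ _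
    omega
  rw [mem_support_iff, coeff_topComponent, if_pos, coeff_permMonomial_perPoly]
  · exact one_ne_zero
  · refine le_antisymm (le_weightedTotalDegree _ (mem_support_iff.mpr ?_)) ?_
    · rw [coeff_permMonomial_perPoly]; exact one_ne_zero
    · have h1 := weight_rect_permMonomial hw σ
      omega

/-! ### The rectangle projection -/

section Proj

variable {j : ℕ} {A₀ B₀ : Finset (Fin n)} {eA : A₀ ≃ Fin j} {eB : B₀ ≃ Fin j}
  {π : Fin n × Fin n → MvPolynomial (Fin j × Fin j) ℝ≥0}

/-- A permutation monomial under a substitution. [folklore] -/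
theorem aeval_monomial_permMonomial (σ : Equiv.Perm (Fin n)) :
    aeval π (monomial (permMonomial σ) (1 : ℝ≥0)) = ∏ i, π (σ i, i) := by
  rw [show (monomial (permMonomial σ) (1 : ℝ≥0) : MvPolynomial _ ℝ≥0) = ∏ i, X (σ i, i)
    by rw [permMonomial, monomial_sum_one]; rfl, map_prod]
  simp only [aeval_X]

/-- A permutation all of whose rectangle cells lie in the block `A₀ × B₀`
(`|B₀| = |A| + |B| - n`) sends exactly the columns `B₀` of `B` into `A`, and maps `B₀` into
`A₀`. [folklore] -/
theorem filter_eq_of_block (hB₀ : B₀ ⊆ B) (hB₀card : B₀.card = A.card + B.card - n)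
    {σ : Equiv.Perm (Fin n)}
    (hblock : ∀ i, σ i ∈ A → i ∈ B → σ i ∈ A₀ ∧ i ∈ B₀) :
    (B.filter fun i => σ i ∈ A) = B₀ ∧ ∀ i, i ∈ B₀ → σ i ∈ A₀ := by
  have hfilter : (B.filter fun i => σ i ∈ A) = B₀ := Finset.eq_of_subset_of_card_le
    (fun i hi => (hblock i (Finset.mem_filter.mp hi).2 (Finset.mem_filter.mp hi).1).2)
    (hB₀card ▸ le_card_filter_perm A B σ)
  exact ⟨hfilter, fun i hi =>
    (hblock i (Finset.mem_filter.mp ((Finset.ext_iff.mp hfilter i).mpr hi)).2 (hB₀ hi)).1⟩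

variable (eA eB) in
/-- **Every permutation of `Fin j` is realised**: there is a permutation of `Fin n` agreeing with
`eA⁻¹ ∘ τ ∘ eB` on `B₀` and sending `B ∖ B₀` outside `A`. [folklore] -/
theorem exists_perm_realising (hA₀ : A₀ ⊆ A) (hB₀ : B₀ ⊆ B)
    (hcard : (B \ B₀).card = (Finset.univ \ A).card) (τ : Equiv.Perm (Fin j)) :
    ∃ σ : Equiv.Perm (Fin n), (∀ k : Fin j, σ (eB.symm k) = eA.symm (τ k)) ∧
      ∀ i ∈ B, i ∉ B₀ → σ i ∉ A := by
  classical
  set emb := Finset.equivOfCardEq hcard with hemb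
  set g : B → Fin n := fun x =>
    if h₀ : (x : Fin n) ∈ B₀ then (eA.symm (τ (eB ⟨x, h₀⟩)) : Fin n)
    else (emb ⟨x, Finset.mem_sdiff.mpr ⟨x.2, h₀⟩⟩ : Fin n) with hg
  have hg1 : ∀ x : B, (x : Fin n) ∈ B₀ → g x ∈ A := fun x hx => by
    simp only [hg, dif_pos hx]
    exact hA₀ (eA.symm _).2
  have hg2 : ∀ x : B, (x : Fin n) ∉ B₀ → g x ∉ A := fun x hx => by
    simp only [hg, dif_neg hx]
    exact (Finset.mem_sdiff.mp (emb _).2).2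
  have hginj : Function.Injective g := by
    intro x y hxy
    by_cases hx : (x : Fin n) ∈ B₀ <;> by_cases hy : (y : Fin n) ∈ B₀
    · simp only [hg, dif_pos hx, dif_pos hy] at hxy
      have h1 := eB.injective (τ.injective (eA.symm.injective (Subtype.ext hxy)))
      exact Subtype.ext (Subtype.mk.inj h1)
    · exact absurd (hg1 x hx) (hxy ▸ hg2 y hy)
    · exact absurd (hg1 y hy) (hxy ▸ hg2 x hx)
    · simp only [hg, dif_neg hx, dif_neg hy] at hxy
      exact Subtype.ext (Subtype.mk.inj (emb.injective (Subtype.ext hxy)))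
  obtain ⟨σ, hσ⟩ := Equiv.Perm.exists_extending_pair (fun x : B => (x : Fin n)) g
    Subtype.val_injective hginj
  refine ⟨σ, fun k => ?_, fun i hi hi₀ => (hσ ⟨i, hi⟩).symm ▸ hg2 ⟨i, hi⟩ hi₀⟩
  have hk : ((eB.symm k : B₀) : Fin n) ∈ B₀ := (eB.symm k).2
  rw [hσ ⟨(eB.symm k : Fin n), hB₀ hk⟩]
  simp only [hg, dif_pos hk, Subtype.coe_eta, Equiv.apply_symm_apply]

/-- Over `ℝ≥0` there is no cancellation in a sum: a monomial of a summand is a monomial of the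
sum. [folklore] -/
theorem mem_support_sum_of_mem_nnreal {ι τ : Type*} {s : Finset ι}
    {f : ι → MvPolynomial τ ℝ≥0} {d : τ →₀ ℕ} {i : ι} (hi : i ∈ s)
    (hd : d ∈ (f i).support) : d ∈ (∑ k ∈ s, f k).support := by
  rw [mem_support_iff, coeff_sum]
  exact fun h0 => (mem_support_iff.mp hd) (Finset.sum_eq_zero_iff.mp h0 i hi)

variable (hπ : ∀ e, π e =
  if h : e.1 ∈ A₀ ∧ e.2 ∈ B₀ then X (eA ⟨e.1, h.1⟩, eB ⟨e.2, h.2⟩)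
  else if e.1 ∈ A ∧ e.2 ∈ B then 0 else 1)
include hπ

/-- The rectangle projection `π` (`x_e ↦ 1` off `A × B`, `↦ 0` on
`(A × B) ∖ (A₀ × B₀)`, `x_{(a,c)} ↦ X (eA a, eB c)` on `A₀ × B₀`) is a projection.
[folklore] -/
theorem isProjection_rectProj (p : MvPolynomial (Fin n × Fin n) ℝ≥0) :
    IsProjection (aeval π p) p := by
  refine ⟨π, fun e => ?_, rfl⟩
  rw [hπ e]
  split_ifs
  exacts [Or.inl ⟨_, rfl⟩, Or.inr ⟨0, C_0.symm⟩, Or.inr ⟨1, C_1.symm⟩]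

/-- Off the rectangle the projection is `1` (when `A₀ ⊆ A`, `B₀ ⊆ B`). [folklore] -/
theorem rectProj_of_not_mem (hA₀ : A₀ ⊆ A) (hB₀ : B₀ ⊆ B) {e : Fin n × Fin n}
    (he : ¬ (e.1 ∈ A ∧ e.2 ∈ B)) : π e = 1 := by
  rw [hπ e, dif_neg (fun h => he ⟨hA₀ h.1, hB₀ h.2⟩), if_neg he]

/-- A polynomial whose monomials avoid the rectangle becomes the constant "sum of its
coefficients" under the projection. [folklore] -/
theorem aeval_rectProj_eq_C (hA₀ : A₀ ⊆ A) (hB₀ : B₀ ⊆ B)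
    {p : MvPolynomial (Fin n × Fin n) ℝ≥0}
    (hp : ∀ v ∈ p.support, ∀ e : Fin n × Fin n, e.1 ∈ A → e.2 ∈ B → v e = 0) :
    aeval π p = C (∑ v ∈ p.support, coeff v p) := by
  classical
  conv_lhs => rw [p.as_sum]
  rw [map_sum, map_sum]
  refine Finset.sum_congr rfl fun v hv => ?_
  rw [aeval_monomial, ← C_eq_algebraMap]
  suffices hq : (v.prod fun e k => π e ^ k) = 1 by rw [hq, mul_one]
  refine Finset.prod_eq_one fun e he => ?_
  have hne : ¬ (e.1 ∈ A ∧ e.2 ∈ B) := fun hR =>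
    (Finsupp.mem_support_iff.mp he) (hp v hv e hR.1 hR.2)
  show π e ^ (v e) = 1
  rw [rectProj_of_not_mem hπ hA₀ hB₀ hne, one_pow]

/-- If the permutation monomial of `σ` survives the projection, every cell of `σ` in the
rectangle lies in the block `A₀ × B₀`. [folklore] -/
theorem block_of_prod_rectProj_ne_zero {σ : Equiv.Perm (Fin n)}
    (hσ : ∏ i, π (σ i, i) ≠ 0) {i : Fin n} (hA : σ i ∈ A) (hB : i ∈ B) :
    σ i ∈ A₀ ∧ i ∈ B₀ := by
  by_contra hnot
  refine hσ (Finset.prod_eq_zero (Finset.mem_univ i) ?_)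
  rw [hπ, dif_neg hnot, if_pos ⟨hA, hB⟩]

/-- **A surviving permutation monomial projects onto the monomial of its block permutation**
`k ↦ eA (σ (eB⁻¹ k))` of `Fin j`. [folklore] -/
theorem prod_rectProj_eq_monomial (hA₀ : A₀ ⊆ A) (hB₀ : B₀ ⊆ B)
    {σ : Equiv.Perm (Fin n)} (hfilter : (B.filter fun i => σ i ∈ A) = B₀)
    (hmap : ∀ i, i ∈ B₀ → σ i ∈ A₀) :
    ∃ τ : Equiv.Perm (Fin j), (∀ k, τ k = eA ⟨σ (eB.symm k), hmap _ (eB.symm k).2⟩) ∧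
      ∏ i, π (σ i, i) = monomial (permMonomial τ) 1 := by
  classical
  refine ⟨Equiv.ofBijective (fun k => eA ⟨σ (eB.symm k), hmap _ (eB.symm k).2⟩)
    (Finite.injective_iff_bijective.mp fun k l hkl => eB.symm.injective
      (Subtype.ext (σ.injective (congrArg Subtype.val (eA.injective hkl))))), fun k => rfl, ?_⟩
  have hone : ∀ i ∈ (Finset.univ : Finset (Fin n)), i ∉ B₀ → π (σ i, i) = 1 := by
    intro i _ hi
    refine rectProj_of_not_mem hπ hA₀ hB₀ fun h => hi ?_
    rw [← hfilter]
    exact Finset.mem_filter.mpr ⟨h.2, h.1⟩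
  rw [← Finset.prod_subset (Finset.subset_univ B₀) hone,
    ← Finset.prod_attach, ← Finset.univ_eq_attach, permMonomial, monomial_sum_one]
  refine Fintype.prod_equiv eB _ _ fun x => ?_
  have hx : (x : Fin n) ∈ B₀ := x.2
  simp only [Equiv.ofBijective_apply, hπ,
    dif_pos (show σ x ∈ A₀ ∧ (x : Fin n) ∈ B₀ from ⟨hmap x hx, hx⟩),
    Equiv.symm_apply_apply, Subtype.coe_eta]
  rfl

/-- **`top_w per_n` projects onto a polynomial with the support of `per_j`.** [folklore] -/
theorem support_aeval_rectProj_topComponent_perPoly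
    (hw : ∀ e, w e = if e.1 ∈ A ∧ e.2 ∈ B then 0 else 1) (hA₀ : A₀ ⊆ A)
    (hB₀ : B₀ ⊆ B) (hB₀card : B₀.card = A.card + B.card - n)
    (hcard : (B \ B₀).card = (Finset.univ \ A).card) :
    (aeval π (topComponent w (perPoly (Fin n) ℝ≥0))).support =
      (perPoly (Fin j) ℝ≥0).support := by
  classical
  set P := topComponent w (perPoly (Fin n) ℝ≥0) with hP
  have hcoeff : ∀ v ∈ P.support, ∃ σ : Equiv.Perm (Fin n),
      v = permMonomial σ ∧ coeff v P = 1 := by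
    intro v hv
    obtain ⟨σ, rfl⟩ := exists_permMonomial_eq_of_coeff_perPoly_ne_zero ℝ≥0
      (mem_support_iff.mp (support_topComponent_subset _ _ hv))
    refine ⟨σ, rfl, ?_⟩
    have h := mem_support_iff.mp hv
    rw [hP, coeff_topComponent] at h ⊢
    split_ifs at h ⊢ with hwt
    · exact coeff_permMonomial_perPoly ℝ≥0 σ
    · exact absurd rfl h
  have hsum : aeval π P = ∑ v ∈ P.support, aeval π (monomial v (1 : ℝ≥0)) := by
    conv_lhs => rw [P.as_sum, map_sum]
    refine Finset.sum_congr rfl fun v hv => ?_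
    obtain ⟨σ, -, h1⟩ := hcoeff v hv
    rw [h1]
  ext v
  rw [hsum]
  constructor
  · intro hv
    obtain ⟨v', hv', hvv'⟩ := Finset.mem_biUnion.mp (support_sum hv)
    obtain ⟨σ, rfl, -⟩ := hcoeff v' hv'
    rw [aeval_monomial_permMonomial] at hvv'
    have hne : ∏ i, π (σ i, i) ≠ 0 := fun h0 => by
      rw [h0, support_zero] at hvv'
      exact Finset.notMem_empty _ hvv'
    obtain ⟨hfilter, hmap⟩ := filter_eq_of_block hB₀ hB₀card
      fun i hA hB => block_of_prod_rectProj_ne_zero hπ hne hA hB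
    obtain ⟨τ, -, hprod⟩ := prod_rectProj_eq_monomial hπ hA₀ hB₀ hfilter hmap
    rw [hprod, support_monomial, if_neg one_ne_zero, Finset.mem_singleton] at hvv'
    rw [hvv', mem_support_iff, coeff_permMonomial_perPoly]; exact one_ne_zero
  · intro hv
    obtain ⟨τ, rfl⟩ :=
      exists_permMonomial_eq_of_coeff_perPoly_ne_zero ℝ≥0 (mem_support_iff.mp hv)
    obtain ⟨σ, hσ₁, hσ₂⟩ := exists_perm_realising eA eB hA₀ hB₀ hcard τ
    have hblock : ∀ i, σ i ∈ A → i ∈ B → σ i ∈ A₀ ∧ i ∈ B₀ := by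
      intro i hA hB
      have hi : i ∈ B₀ := of_not_not fun hi => hσ₂ i hB hi hA
      have h1 := hσ₁ (eB ⟨i, hi⟩)
      rw [Equiv.symm_apply_apply] at h1
      exact ⟨(show σ i = _ from h1) ▸ (eA.symm (τ _)).2, hi⟩
    obtain ⟨hfilter, hmap⟩ := filter_eq_of_block hB₀ hB₀card hblock
    obtain ⟨τ', hτ', hprod⟩ := prod_rectProj_eq_monomial hπ hA₀ hB₀ hfilter hmap
    have hτ : τ' = τ := by
      refine Equiv.ext fun k => ?_
      have h1 : (⟨σ (eB.symm k), hmap _ (eB.symm k).2⟩ : A₀) = eA.symm (τ k) :=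
        Subtype.ext (hσ₁ k)
      rw [hτ' k, h1, Equiv.apply_symm_apply]
    refine mem_support_sum_of_mem_nnreal
      (permMonomial_mem_support_topComponent hw (by rw [hfilter, hB₀card])) ?_
    rw [aeval_monomial_permMonomial, hprod, hτ, support_monomial, if_neg one_ne_zero,
      Finset.mem_singleton]

end Proj

/-- **`stub_rectKill` — the rectangle face (deficiency rung).**  For `h` homogeneous of degree
`d` with a monomial `u` vanishing on the rectangle `A × B` (rows `A`, columns `B`),
`|A| + |B| ≥ n + (log₂ n + c')^{c'}`, and `w = 𝟙` off `A × B`: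
`2^{(log₂ n + c)^c} + 1 < L(top_w (per_n · h))` — `top_w (per_n · h) = top_w per_n · top_w h`
projects to `η · q`, `η ≠ 0`, `supp q = supp per_j` (`j = |A| + |B| - n`); conclude with
`complexity_gt_of_perSupport_projection c 1`. [folklore] -/
theorem stub_rectKill :
    ∀ c : ℕ, ∃ c' n₀ : ℕ, ∀ n ≥ n₀, ∀ (A B : Finset (Fin n))
      (h : MvPolynomial (Fin n × Fin n) ℝ≥0) (d : ℕ) (u : (Fin n × Fin n) →₀ ℕ),
      h.IsHomogeneous d → u ∈ h.support →
      (∀ e : Fin n × Fin n, e.1 ∈ A → e.2 ∈ B → u e = 0) →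
      n + (Nat.log 2 n + c') ^ c' ≤ A.card + B.card →
      2 ^ ((Nat.log 2 n + c) ^ c) + 1 <
        complexity (topComponent (fun e : Fin n × Fin n => if e.1 ∈ A ∧ e.2 ∈ B then 0 else 1)
          (perPoly (Fin n) ℝ≥0 * h)) := by
  classical
  intro c
  obtain ⟨c', n₁, harsenal⟩ := complexity_gt_of_perSupport_projection c 1
  refine ⟨c', n₁, fun n hn A B h d u hhom hu havoid hAB => ?_⟩
  suffices H : ∀ w : Fin n × Fin n → ℕ,
      (∀ e, w e = if e.1 ∈ A ∧ e.2 ∈ B then 0 else 1) → 2 ^ ((Nat.log 2 n + c) ^ c) + 1 <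
        complexity (topComponent w (perPoly (Fin n) ℝ≥0 * h)) from
    H (fun e => if e.1 ∈ A ∧ e.2 ∈ B then 0 else 1) fun e => rfl
  intro w hw
  have hAn : A.card ≤ n ∧ B.card ≤ n :=
    ⟨A.card_le_univ.trans_eq (Fintype.card_fin n), B.card_le_univ.trans_eq (Fintype.card_fin n)⟩
  obtain ⟨A₀, hA₀, hA₀card⟩ :=
    Finset.exists_subset_card_eq (show A.card + B.card - n ≤ A.card by omega)
  obtain ⟨B₀, hB₀, hB₀card⟩ :=
    Finset.exists_subset_card_eq (show A.card + B.card - n ≤ B.card by omega)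
  have hcard : (B \ B₀).card = (Finset.univ \ A).card := by
    rw [Finset.card_sdiff_of_subset hB₀, Finset.card_sdiff_of_subset (Finset.subset_univ A),
      Finset.card_univ, Fintype.card_fin, hB₀card]
    omega
  -- the rectangle projection onto the `j × j` block `A₀ × B₀`, `j = |A| + |B| - n`
  set eA := Finset.equivFinOfCardEq hA₀card with heA
  set eB := Finset.equivFinOfCardEq hB₀card with heB
  obtain ⟨π, hπ⟩ : ∃ π : Fin n × Fin n →
      MvPolynomial (Fin (A.card + B.card - n) × Fin (A.card + B.card - n)) ℝ≥0, ∀ e, π e =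
        if h' : e.1 ∈ A₀ ∧ e.2 ∈ B₀ then X (eA ⟨e.1, h'.1⟩, eB ⟨e.2, h'.2⟩)
        else if e.1 ∈ A ∧ e.2 ∈ B then 0 else 1 := ⟨_, fun e => rfl⟩
  have hHne : topComponent w h ≠ 0 :=
    topComponent_ne_zero _ (ne_zero_iff.mpr ⟨u, mem_support_iff.mp hu⟩)
  have hHC : aeval π (topComponent w h) = C _ :=
    aeval_rectProj_eq_C hπ hA₀ hB₀ fun v hv =>
      avoids_of_mem_support_topComponent hw hhom hu havoid hv
  have hsupp : (aeval π (topComponent w (perPoly (Fin n) ℝ≥0 * h))).support =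
      (perPoly (Fin (A.card + B.card - n)) ℝ≥0).support := by
    rw [topComponent_mul, map_mul, hHC, mul_comm, ← smul_eq_C_mul,
      JerrumSnir.support_smul_eq (sum_coeff_ne_zero hHne)]
    exact support_aeval_rectProj_topComponent_perPoly hπ hw hA₀ hB₀ hB₀card hcard
  have hlt := harsenal n hn (A.card + B.card - n) (by omega) _
    ⟨_, isProjection_rectProj hπ _, hsupp⟩
  have h2 : 2 * (2 ^ ((Nat.log 2 n + c) ^ c) + 3) ≤
      (n + 2) * (2 ^ ((Nat.log 2 n + c) ^ c) + 3) := Nat.mul_le_mul_right _ (by omega)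
  rw [pow_one] at hlt
  omega

end Summit.ValiantsHypothesis.ValiantsHypothesis.Theorems.DivisionGapPerDivisionHard

end
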